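import Literature.Probability.LatticeModels.KCModifiedDecaySub
import Literature.Probability.LatticeModels.KCBoundarySmallness
import HarnessLib

/-!
# The Dirichlet boundary condition of the Kadanoff–Ceva primitive, lattice form (CHI15 §3.4, eq. (3.20))

Topic `Literature/Probability/LatticeModels`. Chelkak–Hongler–Izyurov 2015, proof of Thm 2.16
(§3.4): "By maximum principle for `H_δ` (see Remark 3.7), taking into account that `H_δ ≡ 0` on
`∂Ω_δ`, we have `H•_δ(z) ≥ -C(ε)(1 - hm(z))`, `H°_δ(z) ≤ C(ε)(1 - hm(z))` (3.20). Since `hm → 1`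
uniformly in `δ` as `z` approaches the boundary, this implies `h̃ ≡ 0` on `∂Ω`." Here `H•` is
superharmonic for the boundary-MODIFIED Laplacian of Prop. 3.6 with `H• := 0` on the boundary
vertices. In the tree's orientation `(Hw, Hb) = -(H°, H•)` (Kadanoff–Ceva primitive pair of
`IsingDisorderLaplacian.lean`, frozen boundary value `c = Hw|_∂`, `KCFrozenBoundaryConnected.lean`)
this file proves the two one-sided estimates near a frozen site, with the weak Beurling decay:

* **`IsKCPrimitive.le_hw_near_frozen`** (lower bound, sites): `Hw` is superharmonic at the free sites
  off `B` and `= c` on the frozen sites, so near a frozen site `p`, `R` lattice units away from `B`,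
  `Hw ≥ c - (c - m) · C((ρ+1)/(R+1))^β` on `Λ ∩ sqBox p ρ`, `m ≤ Hw` being required ONLY on the rim
  `Λ ∩ (sqBox p (R+1) ∖ sqBox p R)` (the variant `le_hw_of_boundary'` of
  `KCBoundarySmallness.le_hw_of_boundary` with boundary-only hypotheses, plus
  `latticeHM_sites_compl_sqBox_le`);
* **`IsKCPrimitive.hb_le_near_frozen`** (upper bound, plaquettes): `Hb` is subharmonic at the
  all-touch plaquettes other than the source (`latticeLaplacian_black_nonneg`) and satisfies the
  modified inequality `kcModLaplacian ≥ 0` at the touching plaquettes with a frozen side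
  (`IsKCPrimitive.kcModLaplacian_nonneg`, cemetery `Hw = c`), whence the CONTRACTION
  `Hb - c ≤ θ₀ · max over touching neighbours` there (`sub_le_contract_of_kcModLaplacian_nonneg`);
  so near a frozen bond `{a, a + e_{k₀}}`, `R₀` lattice units away from the source plaquette, an
  a-priori bound `Hb ≤ c + K` on the touching plaquettes of the box gives
  `Hb ≤ c + K · A((r+1)/(R₀+1))^γ` on the touching plaquettes of `sqBox (faceAt a j₀) r`
  (`decaySub_of_cuts` with the plaquette walk along frozen bonds `exists_plaqWalk_along` as cuts).
  No jump term appears (contrast `KCBoundarySmallness.hb_le_near_boundary`, whose boundary value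
  `b` carries the squared corner value).

Everything is proved; no named fact.

## References

* D. Chelkak, C. Hongler, K. Izyurov, Ann. of Math. 181 (2015), Prop. 3.6, Remark 3.7, §3.4 (3.20)
  [ChelkakHonglerIzyurovAnnals2015].
* D. Chelkak, S. Smirnov, Invent. Math. 189 (2012), §3.6 and proof of Thm. 6.1 [ChelkakSmirnov2012Ising].
* S. Smirnov, Ann. of Math. 172 (2010), App. B, Lemma B.2 [Smirnov2010].
-/

noncomputable section

namespace Literature.Probability.LatticeModels

open Finset Set SimpleGraph WeakBeurling

/-! ### Touching neighbours and the contraction at a plaquette with a frozen side -/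

/-- `j + 3 + 1 = j` and `j + 3 + 1 + 1 = j + 1` in `Fin 4`. [folklore] -/
theorem fin4_add_three_succ (j : Fin 4) : j + 3 + 1 = j ∧ j + 3 + 1 + 1 = j + 1 := by
  revert j; decide

/-- The neighbour across a touching side touches the free sites. [folklore] -/
theorem sideNbr_mem_touchPlaquettes {Λ : Finset (Site 2)} {f : Site 2} {j : Fin 4} (h : SideTouch Λ f j) :
    sideNbr f j ∈ touchPlaquettes Λ := by
  rw [sideNbr]
  apply add_cornerUnit_mem_touchPlaquettes
  rw [(fin4_add_three_succ j).1]
  rcases h with h | h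
  · exact Or.inl h
  · right; rwa [add_cornerOff_succ]

/-- `f + cornerUnit k = sideNbr f (k + 1)`. [folklore] -/
theorem add_cornerUnit_eq_sideNbr (f : Site 2) (k : Fin 4) : f + cornerUnit k = sideNbr f (k + 1) := by
  rw [sideNbr]; congr 1; revert k; decide

/-- A plaquette all of whose sides touch (in the `SideTouch` sense) is an all-touch plaquette. [folklore] -/
theorem mem_allTouchPlaquettes_of_sideTouch {Λ : Finset (Site 2)} {f : Site 2} (hf : f ∈ touchPlaquettes Λ)
    (h : ∀ j : Fin 4, SideTouch Λ f j) : f ∈ allTouchPlaquettes Λ := by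
  rw [mem_allTouchPlaquettes]
  refine ⟨hf, fun j => ?_⟩
  rcases h j with h | h
  · exact Or.inl h
  · right; rwa [add_cornerOff_succ]

/-- **The contraction at a plaquette with a frozen side and dead cemetery**: if
`kcModLaplacian Λ g u f ≥ 0`, `f` has a non-touching side, `g ≤ 0` at the frozen corners of the
non-touching sides and `u ≤ m` (`m ≥ 0`) at the touching neighbours, then `u f ≤ (3/(3+κ)) · m`.
[cite: ChelkakSmirnov2012Ising, §3.6 and proof of Thm. 6.1] -/
theorem le_contract_of_kcModLaplacian_nonneg (Λ : Finset (Site 2)) {g u : Site 2 → ℝ} {f : Site 2}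
    (hL : 0 ≤ kcModLaplacian Λ g u f) {j₀ : Fin 4} (hj₀ : ¬ SideTouch Λ f j₀)
    (hg : ∀ j : Fin 4, ¬ SideTouch Λ f j → g (f + cornerOff j) ≤ 0)
    {m : ℝ} (hm0 : 0 ≤ m) (hm : ∀ j : Fin 4, SideTouch Λ f j → u (sideNbr f j) ≤ m) :
    u f ≤ endTheta * m := by
  classical
  rw [kcModLaplacian_eq_sum] at hL
  set nt : ℝ := ∑ j : Fin 4, (if SideTouch Λ f j then (1 : ℝ) else 0) with hnt
  set nf : ℝ := ∑ j : Fin 4, (if SideTouch Λ f j then (0 : ℝ) else 1) with hnf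
  -- termwise bound: `touching ≤ m - u f`, `frozen ≤ κ (0 - u f)`
  have hterm : ∀ j ∈ (univ : Finset (Fin 4)),
      (if SideTouch Λ f j then u (sideNbr f j) - u f else modKappa * (g (f + cornerOff j) - u f)) ≤
        (if SideTouch Λ f j then (1 : ℝ) else 0) * (m - u f) + (if SideTouch Λ f j then (0 : ℝ) else 1) * (modKappa * (0 - u f)) := by
    intro j _
    by_cases h : SideTouch Λ f j
    · simp only [if_pos h, one_mul, zero_mul, add_zero]
      linarith [hm j h]
    · simp only [if_neg h, zero_mul, one_mul, zero_add]
      have := hg j h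
      nlinarith [modKappa_pos]
  have hsum := Finset.sum_le_sum hterm
  have hsplit : ∑ j : Fin 4, ((if SideTouch Λ f j then (1 : ℝ) else 0) * (m - u f) +
      (if SideTouch Λ f j then (0 : ℝ) else 1) * (modKappa * (0 - u f))) = nt * (m - u f) + nf * (modKappa * (0 - u f)) := by
    rw [Finset.sum_add_distrib, hnt, hnf, Finset.sum_mul, Finset.sum_mul]
  rw [hsplit] at hsum
  have hkey : 0 ≤ nt * (m - u f) + nf * (modKappa * (0 - u f)) := hL.trans hsum
  have hsum4 : nt + nf = 4 := by
    rw [hnt, hnf, ← Finset.sum_add_distrib]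
    rw [show ∑ j : Fin 4, ((if SideTouch Λ f j then (1 : ℝ) else 0) + if SideTouch Λ f j then (0 : ℝ) else 1) =
      ∑ _j : Fin 4, (1 : ℝ) from Finset.sum_congr rfl fun j _ => by split_ifs <;> ring]
    simp
  have hnf1 : 1 ≤ nf := by
    have hterm' : ∀ j ∈ (univ : Finset (Fin 4)), 0 ≤ (if SideTouch Λ f j then (0 : ℝ) else 1) := fun j _ => by
      split_ifs <;> norm_num
    have := Finset.single_le_sum hterm' (mem_univ j₀)
    rwa [if_neg hj₀] at this
  have hnt0 : 0 ≤ nt := Finset.sum_nonneg fun j _ => by split_ifs <;> norm_num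
  have hnt3 : nt ≤ 3 := by linarith
  have hκ := modKappa_pos
  have hθ : endTheta = 3 / (3 + modKappa) := rfl
  rw [hθ]
  -- `(nt + κ nf) u f ≤ nt m`
  have h1 : (nt + modKappa * nf) * u f ≤ nt * m := by nlinarith
  by_cases hu : u f ≤ 0
  · exact hu.trans (by positivity)
  · push Not at hu
    have h2 : (nt + modKappa) * u f ≤ nt * m := by
      have : 0 ≤ modKappa * (nf - 1) * u f := mul_nonneg (mul_nonneg hκ.le (by linarith)) hu.le
      nlinarith
    have h3 : (3 + modKappa) * u f * (nt + modKappa) ≤ (3 + modKappa) * (nt * m) := by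
      have := mul_le_mul_of_nonneg_left h2 (by positivity : (0 : ℝ) ≤ 3 + modKappa)
      nlinarith
    have h4 : (3 + modKappa) * (nt * m) ≤ 3 * m * (nt + modKappa) := by
      have : 0 ≤ modKappa * m * (3 - nt) := mul_nonneg (mul_nonneg hκ.le hm0) (by linarith)
      nlinarith
    have h5 : (3 + modKappa) * u f ≤ 3 * m := le_of_mul_le_mul_right (h3.trans h4) (by positivity)
    rw [div_mul_eq_mul_div, le_div_iff₀ (by positivity)]
    linarith

/-! ### The lattice estimates near a frozen site -/

section Lattice

variable {G₂ : SimpleGraph (Site 2)} [G₂.LocallyFinite] {Λ : Finset (Site 2)} {η : SpinConfig (Site 2)}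
  {B : Finset (Site 2)} {cut : Site 2 → Finset (Sym2 (Site 2))} {Hw Hb : Site 2 → ℝ}

/-- **Lower two-constant bound for `Hw` with boundary-only hypotheses**: as
`KCBoundarySmallness.le_hw_of_boundary`, but `m ≤ Hw` is required only at the sites of the excised
set `D` adjacent to `Λ ∖ D`, and the background spins are only required to be off `Λ ∖ D`. [cite: ChelkakHonglerIzyurovAnnals2015, §3.4 eq. (3.13) and Remark 3.7] -/
theorem IsKCPrimitive.le_hw_of_boundary' (hG : ∀ v ∈ Λ, ∀ k : Fin 4, G₂.Adj v (v + cornerUnit k)) (hle : G₂ ≤ zdGraph 2)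
    (h : IsKCPrimitive G₂ Λ criticalBetaTwo (.fixed η) B cut Hw Hb ↑(fillFinset (touchPlaquettes Λ)))
    (hc : IsKCCuts G₂ Λ cut ↑(fillFinset (touchPlaquettes Λ)))
    {D S : Set (Site 2)} (hBD : ∀ v ∈ ((↑Λ : Set (Site 2)) \ D), v ∉ B) (hDS : D ⊆ S) {c m : ℝ} (hmc : m ≤ c)
    (hcst : ∀ (v : Site 2) (k : Fin 4), v ∉ Λ → faceAt v k ∈ fillFinset (touchPlaquettes Λ) → Hw v = c)
    (hm : ∀ w ∈ latticeOuterBoundary ((↑Λ : Set (Site 2)) \ D), w ∈ Λ → m ≤ Hw w) :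
    ∀ z ∈ ((↑Λ : Set (Site 2)) \ D), c - (c - m) * latticeHM ((↑Λ : Set (Site 2)) \ D) S z ≤ Hw z := by
  have hT : ((↑Λ : Set (Site 2)) \ D).Finite := (Finset.finite_toSet _).subset fun _ hx => hx.1
  have hsup : IsLatticeSuperharmonicOn Hw ((↑Λ : Set (Site 2)) \ D) := fun v hv =>
    h.latticeLaplacian_white_nonpos_of_mem _ hG hle hc hv.1 (hBD v hv)
  have hbd : ∀ w ∈ latticeOuterBoundary ((↑Λ : Set (Site 2)) \ D), (w ∉ Λ → Hw w = c) ∧ (w ∈ Λ → w ∈ D) := by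
    rintro w ⟨hwT, v, ⟨hv, -⟩, k, rfl⟩
    refine ⟨fun hwΛ => hcst _ (k + 1) hwΛ ?_, fun hwΛ => ?_⟩
    · rw [faceAt_add_unit_succ]
      exact subset_fillFinset _ (faceAt_mem_touchPlaquettes hv k)
    · by_contra hwD
      exact hwT ⟨hwΛ, hwD⟩
  intro z hz
  have key := le_add_mul_latticeHM hT hsup.neg (M := -m) (m := -c) (B := S) (fun w hw => ?_) (fun w hw hwS => ?_) z hz
  · simp only [Pi.neg_apply] at key
    nlinarith [key]
  · rw [Pi.neg_apply]
    by_cases hwΛ : w ∈ Λ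
    · have := hm w hw hwΛ; linarith
    · rw [(hbd w hw).1 hwΛ]; linarith
  · rw [Pi.neg_apply]
    have hwΛ : w ∉ Λ := fun hwΛ => hwS (hDS ((hbd w hw).2 hwΛ))
    rw [(hbd w hw).1 hwΛ]

/-- **CHI (3.20), white part, near a frozen site**: `Hw ≥ c - (c - m) · C((ρ+1)/(R+1))^β` on
`Λ ∩ sqBox p ρ` (`ρ ≤ R`) for a frozen site `p` of a hole-free `Λ`, provided the background spins are
outside `sqBox p R` and `m ≤ Hw` (`m ≤ c`) on the rim `Λ ∩ (sqBox p (R+1) ∖ sqBox p R)`. [cite: ChelkakHonglerIzyurovAnnals2015, §3.4 eq. (3.20)] -/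
theorem IsKCPrimitive.le_hw_near_frozen (hG : ∀ v ∈ Λ, ∀ k : Fin 4, G₂.Adj v (v + cornerUnit k)) (hle : G₂ ≤ zdGraph 2)
    (h : IsKCPrimitive G₂ Λ criticalBetaTwo (.fixed η) B cut Hw Hb ↑(fillFinset (touchPlaquettes Λ)))
    (hc : IsKCCuts G₂ Λ cut ↑(fillFinset (touchPlaquettes Λ))) (hΛ : HoleFree (↑Λ : Set (Site 2)))
    {p : Site 2} (hp : p ∉ Λ) {R : ℕ} (hBfar : ∀ b ∈ B, b ∉ sqBox p R) {c m : ℝ} (hmc : m ≤ c)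
    (hcst : ∀ (v : Site 2) (k : Fin 4), v ∉ Λ → faceAt v k ∈ fillFinset (touchPlaquettes Λ) → Hw v = c)
    (hm : ∀ w ∈ Λ, w ∉ sqBox p R → w ∈ sqBox p ((R : ℤ) + 1) → m ≤ Hw w)
    {ρ : ℕ} (hρR : ρ ≤ R) {z : Site 2} (hz : z ∈ Λ) (hzρ : z ∈ sqBox p ρ) :
    c - (c - m) * (beurlingConst * (((ρ : ℝ) + 1) / ((R : ℝ) + 1)) ^ beurlingExp) ≤ Hw z := by
  obtain ⟨D, hD⟩ : ∃ D : Set (Site 2), D = {w | w ∈ Λ ∧ w ∉ sqBox p R} := ⟨_, rfl⟩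
  have hmemD : ∀ w, w ∈ D ↔ w ∈ Λ ∧ w ∉ sqBox p R := fun w => by rw [hD]; rfl
  have hin : ∀ v ∈ ((↑Λ : Set (Site 2)) \ D), v ∈ sqBox p R := fun v hv => by
    by_contra hvR; exact hv.2 ((hmemD v).2 ⟨hv.1, hvR⟩)
  have hBD : ∀ v ∈ ((↑Λ : Set (Site 2)) \ D), v ∉ B := fun v hv hvB => hBfar v hvB (hin v hv)
  have hDS : D ⊆ (sqBox p R)ᶜ := fun w hw => ((hmemD w).1 hw).2
  have hm' : ∀ w ∈ latticeOuterBoundary ((↑Λ : Set (Site 2)) \ D), w ∈ Λ → m ≤ Hw w := by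
    rintro w ⟨hwT, v, hv, k, rfl⟩ hwΛ
    have hwD : v + cornerUnit k ∉ sqBox p R := fun hwR => hwT ⟨hwΛ, fun hwD => ((hmemD _).1 hwD).2 hwR⟩
    exact hm _ hwΛ hwD (mem_sqBox_succ_of_adj (hin v hv) (zdGraph_adj_add_cornerUnit v k))
  have hρR' : (ρ : ℤ) ≤ (R : ℤ) := by exact_mod_cast hρR
  have hzT : z ∈ ((↑Λ : Set (Site 2)) \ D) := ⟨hz, fun hzD => ((hmemD z).1 hzD).2 (sqBox_mono p hρR' hzρ)⟩
  have h1 := h.le_hw_of_boundary' hG hle hc hBD hDS hmc hcst hm' z hzT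
  have h2 := latticeHM_sites_compl_sqBox_le hΛ D hp R hzT hzρ
  nlinarith [h1, h2, sub_nonneg.2 hmc]

/-- **CHI (3.20), black part, near a frozen bond, via the boundary modification** (no jump term):
let `{a, a + e_{k₀}}` be a frozen bond of a hole-free `Λ`, `c₀ = faceAt a j₀` (`j₀ ∈ {k₀, k₀+3}`) a
plaquette containing it, the source plaquette outside `sqBox c₀ R₀`, `Hw = c` on the frozen corners
of the system and `Hb ≤ c + K` (`K > 0`) on the touching plaquettes of `sqBox c₀ (R₀ + 1)`. Then
`Hb ≤ c + K · A((r+1)/(R₀+1))^γ` on the touching plaquettes of `sqBox c₀ r`, `r ≤ R₀`. [cite: ChelkakHonglerIzyurovAnnals2015, Prop. 3.6 and §3.4 eq. (3.20); ChelkakSmirnov2012Ising, proof of Thm. 6.1] -/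
theorem IsKCPrimitive.hb_le_near_frozen (hG : ∀ v ∈ Λ, ∀ k : Fin 4, G₂.Adj v (v + cornerUnit k))
    (hη : ∀ v w : Site 2, spinAt v η = spinAt w η)
    (h : IsKCPrimitive G₂ Λ criticalBetaTwo (.fixed η) B cut Hw Hb ↑(fillFinset (touchPlaquettes Λ)))
    (hc : IsKCCuts G₂ Λ cut ↑(fillFinset (touchPlaquettes Λ))) (hΛ : HoleFree (↑Λ : Set (Site 2))) {p₀ : Site 2}
    (hodd : ∀ p ∈ touchPlaquettes Λ, p ≠ p₀ → Odd #(Finset.univ.filter fun j : Fin 4 => plaqSide p j ∈ cut p))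
    {c : ℝ} (hcst : ∀ (v : Site 2) (k : Fin 4), v ∉ Λ → faceAt v k ∈ fillFinset (touchPlaquettes Λ) → Hw v = c)
    {a : Site 2} {k₀ j₀ : Fin 4} (ha : a ∉ Λ) (hk₀ : a + cornerUnit k₀ ∉ Λ) (hj₀ : j₀ = k₀ ∨ j₀ = k₀ + 3)
    {R₀ : ℕ} (hp₀ : p₀ ∉ sqBox (faceAt a j₀) R₀) {K : ℝ} (hK : 0 < K)
    (hbd : ∀ q ∈ touchPlaquettes Λ, q ∈ sqBox (faceAt a j₀) ((R₀ : ℤ) + 1) → Hb q ≤ c + K)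
    {r : ℕ} (hr : r ≤ R₀) {w : Site 2} (hw : w ∈ touchPlaquettes Λ) (hwr : w ∈ sqBox (faceAt a j₀) r) :
    Hb w ≤ c + K * (endDecayConst * endProfile R₀ r) := by
  classical
  obtain ⟨c₀, hc₀⟩ : ∃ c₀ : Site 2, c₀ = faceAt a j₀ := ⟨_, rfl⟩
  rw [← hc₀] at hp₀ hbd hwr
  obtain ⟨D, hD⟩ : ∃ D : Finset (Site 2), D = (touchPlaquettes Λ).filter fun f => f ∈ sqBox c₀ R₀ := ⟨_, rfl⟩
  obtain ⟨V, hV⟩ : ∃ V : Site 2 → ℝ,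
      V = fun x => if x ∈ touchPlaquettes Λ ∧ x ∈ sqBox c₀ ((R₀ : ℤ) + 1) then (Hb x - c) / K else 0 := ⟨_, rfl⟩
  have hVapp : ∀ x, V x = if x ∈ touchPlaquettes Λ ∧ x ∈ sqBox c₀ ((R₀ : ℤ) + 1) then (Hb x - c) / K else 0 :=
    fun x => by rw [hV]
  have hP : (↑(touchPlaquettes Λ) : Set (Site 2)) ⊆ ↑(fillFinset (touchPlaquettes Λ)) := Finset.coe_subset.2 (subset_fillFinset _)
  have hmemD : ∀ {f}, f ∈ D ↔ f ∈ touchPlaquettes Λ ∧ f ∈ sqBox c₀ R₀ := fun {f} => by rw [hD, Finset.mem_filter]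
  have hVeq : ∀ x, x ∈ touchPlaquettes Λ → x ∈ sqBox c₀ ((R₀ : ℤ) + 1) → V x = (Hb x - c) / K := fun x hx hx' => by
    rw [hVapp, if_pos (And.intro hx hx')]
  have hVeqD : ∀ x ∈ D, V x = (Hb x - c) / K := fun x hx =>
    hVeq x (hmemD.1 hx).1 (sqBox_mono c₀ (by omega) (hmemD.1 hx).2)
  -- `V ≤ 1`
  have hV1 : ∀ x, V x ≤ 1 := by
    intro x
    by_cases hx : x ∈ touchPlaquettes Λ ∧ x ∈ sqBox c₀ ((R₀ : ℤ) + 1)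
    · rw [hVeq x hx.1 hx.2, div_le_one hK]
      linarith [hbd x hx.1 hx.2]
    · rw [hVapp, if_neg hx]; exact zero_le_one
  -- closure of `D`
  have hDcl : ∀ f ∈ D, ∀ j : Fin 4, SideTouch Λ f j → sideNbr f j ∈ sqBox c₀ R₀ → sideNbr f j ∈ D :=
    fun f _ j hj hbox => hmemD.2 ⟨sideNbr_mem_touchPlaquettes hj, hbox⟩
  -- touching neighbours of plaquettes of `D` are in the larger box
  have hnbr : ∀ f ∈ D, ∀ j : Fin 4, SideTouch Λ f j →
      sideNbr f j ∈ touchPlaquettes Λ ∧ sideNbr f j ∈ sqBox c₀ ((R₀ : ℤ) + 1) := fun f hf j hj =>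
    ⟨sideNbr_mem_touchPlaquettes hj,
      mem_sqBox_succ_of_adj (hmemD.1 hf).2 (by rw [sideNbr]; exact zdGraph_adj_add_cornerUnit f (j + 3))⟩
  have hne : ∀ f ∈ D, f ≠ p₀ := fun f hf hfp => hp₀ (hfp ▸ (hmemD.1 hf).2)
  -- subharmonicity at the all-touch plaquettes of `D`
  have hsub : ∀ f ∈ D, (∀ j : Fin 4, SideTouch Λ f j) → 0 ≤ latticeLaplacian V f := by
    intro f hf hall
    have hft : f ∈ touchPlaquettes Λ := (hmemD.1 hf).1
    have hfall : f ∈ allTouchPlaquettes Λ := mem_allTouchPlaquettes_of_sideTouch hft hall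
    have hΔ : 0 ≤ latticeLaplacian Hb f :=
      h.subharmonicOn_hb hG hc hodd (D := {p₀}) (Set.mem_singleton p₀) f ⟨hfall, fun hfp => hne f hf hfp⟩
    have hrel : latticeLaplacian V f = latticeLaplacian Hb f / K := by
      rw [latticeLaplacian, latticeLaplacian, Finset.sum_div]
      refine Finset.sum_congr rfl fun k _ => ?_
      obtain ⟨h1, h2⟩ := hnbr f hf (k + 1) (hall (k + 1))
      rw [← add_cornerUnit_eq_sideNbr] at h1 h2
      rw [hVeq _ h1 h2, hVeqD f hf]
      ring
    rw [hrel]; positivity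
  -- the contraction at the plaquettes of `D` with a frozen side
  have hcontr : ∀ g ∈ D, g ∈ sqBox c₀ R₀ → (∃ j : Fin 4, ¬ SideTouch Λ g j) → ∀ m : ℝ, 0 ≤ m →
      (∀ j : Fin 4, SideTouch Λ g j → V (sideNbr g j) ≤ m) → V g ≤ endTheta * m := by
    intro g hg _ hex m hm0 hm
    obtain ⟨j₀', hj₀'⟩ := hex
    have hgt : g ∈ touchPlaquettes Λ := (hmemD.1 hg).1
    have hgP : g ∈ (↑(fillFinset (touchPlaquettes Λ)) : Set (Site 2)) := hP (Finset.mem_coe.2 hgt)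
    -- the modified inequality for `((Hw - c)/K, (Hb - c)/K)`
    have hL0 : 0 ≤ kcModLaplacian Λ Hw Hb g :=
      h.kcModLaplacian_nonneg _ hη hc hgP (fun j hj => hP (Finset.mem_coe.2 (by
        have := sideNbr_mem_touchPlaquettes (Λ := Λ) (f := g) (j := j) hj
        rwa [sideNbr] at this))) (by simpa [plaqSide] using hodd g hgt (hne g hg))
    have hL : 0 ≤ kcModLaplacian Λ (fun x => (Hw x - c) / K) (fun x => (Hb x - c) / K) g := by
      have e : kcModLaplacian Λ (fun x => (Hw x - c) / K) (fun x => (Hb x - c) / K) g =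
          K⁻¹ * kcModLaplacian Λ Hw Hb g := by
        rw [← kcModLaplacian_sub_const Λ Hw Hb c g, ← kcModLaplacian_smul]
        congr 1 <;> funext x <;> ring
      rw [e]; positivity
    have hgc : ∀ j : Fin 4, ¬ SideTouch Λ g j → (fun x => (Hw x - c) / K) (g + cornerOff j) ≤ 0 := by
      intro j hj
      have hfro : g + cornerOff j ∉ Λ := fun hin => hj (Or.inl hin)
      have hk : faceAt (g + cornerOff j) j ∈ fillFinset (touchPlaquettes Λ) := by
        rw [faceAt_add_cornerOff]; exact subset_fillFinset _ hgt
      simp only [hcst _ j hfro hk, sub_self, zero_div, le_refl]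
    have hm' : ∀ j : Fin 4, SideTouch Λ g j → (fun x => (Hb x - c) / K) (sideNbr g j) ≤ m := by
      intro j hj
      obtain ⟨h1, h2⟩ := hnbr g hg j hj
      have := hm j hj
      rwa [hVeq _ h1 h2] at this
    have key := le_contract_of_kcModLaplacian_nonneg Λ hL hj₀' hgc hm0 hm'
    rwa [hVeqD g hg]
  -- the cuts: the plaquette walk along a walk of frozen sites reaching high
  have hcut : ∀ R : ℕ, R < R₀ → ∃ (d : Site 2) (q : (zdGraph 2).Walk c₀ d), d ∉ sqBox c₀ R ∧
      ∀ z ∈ q.support, ¬ (z ∈ D ∧ ∀ j : Fin 4, SideTouch Λ z j) := by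
    intro R _
    obtain ⟨b, W, hb, hW⟩ := exists_walk_high_of_holeFree hΛ ha (a 1 + R + 2)
    obtain ⟨m, Q, hQ⟩ := exists_plaqWalk_along W hW hk₀ j₀ hj₀
    refine ⟨faceAt b m, Q.copy hc₀.symm rfl, fun hd => ?_, fun z hz hzT =>
      hQ z (by rwa [Walk.support_copy] at hz) (mem_allTouchPlaquettes_of_sideTouch (hmemD.1 hzT.1).1 hzT.2)⟩
    rw [hc₀, mem_sqBox] at hd
    have h1 : (faceAt b m) 1 = b 1 - (cornerOff m) 1 := by simp [faceAt]
    have h2 : (faceAt a j₀) 1 = a 1 - (cornerOff j₀) 1 := by simp [faceAt]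
    have hm1 : (cornerOff m) 1 = 0 ∨ (cornerOff m) 1 = 1 := by fin_cases m <;> simp [cornerOff]
    have hj1 : (cornerOff j₀) 1 = 0 ∨ (cornerOff j₀) 1 = 1 := by fin_cases j₀ <;> simp [cornerOff]
    have := hd.2
    rw [h1, h2, abs_le] at this
    rcases hm1 with hm1 | hm1 <;> rcases hj1 with hj1 | hj1 <;> rw [hm1, hj1] at this <;> omega
  -- the decay
  have hwD : w ∈ D := hmemD.2 ⟨hw, sqBox_mono c₀ (by exact_mod_cast hr) hwr⟩
  have key := decaySub_of_cuts Λ hV1 hDcl hsub hcontr hcut r hr w hwD hwr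
  rw [hVeqD w hwD, div_le_iff₀ hK] at key
  linarith

end Lattice

end Literature.Probability.LatticeModels
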